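import Literature.MathematicalPhysics.QuantumFieldTheory.Balaban1983to89.B5G183RateObstructionOp

/-!
# Bałaban [CMP 95 (1984)] (1.83)/(1.89) at `U = 1`, ORDER TWO: the free diagonal with TWO derivative
weights HAS an eta-rate once King's alias weights (4.20) are inserted — the symbol-level positive
counterpart of the no-go `B5G183RateObstructionOp.not_orderTwoOpRateResidual`

HONEST FRAMING (cell `pub-balaban`, T⁴ programme, estimate NE2 = U1a «η-rate, linear theory»).  Finite
torus, lattice spacing `η = 1/n`, trivial background `U = 1`, a fixed NONZERO reduced momentum `p′ = s`;
symbol level only (one alias class at a time).  Nothing here is about infinite volume, `U ≠ 1`, a mass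
gap, or any summit statement.  Bałaban prints NO rate; the alias weights are KING's ([King1986] (4.20)
p. 672: `|u(p′+l)| ≤ Π_μ |p′_μ| |p′_μ + l_μ|⁻¹`, in the tree as `King1986.aliasWeight`); every constant and
the pairing are OURS ([folklore]).

WHAT IS PRINTED.  [Balaban1984PropagatorsI] p. 33: «Proposition 1.1. The operator G is a symmetric
operator on L²(T_η) and ‖GJ‖, ‖∇GJ‖, ‖G∇*J‖, ‖∇G∇*J‖, ‖∇∇GJ‖, ‖G∇*∇*J‖ ≤ γ₀⁻¹‖J‖, (1.89)»; p. 32: «It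
is bounded also when differentiated two times at most.»  [King1986] p. 672: «To analyze the m = 0 term
in (4.19), we successively replace each factor by the corresponding one … and bound the error. We must
always be careful to keep enough negative powers of momentum so that» the sum over `l` is bounded
(p. 673, first line), with the legends (4.22) «≤ C for α < 1.» and (4.23) «≤ CL^{−γk} for α + γ < 1»,
and p. 673 (4.24) «≤ C|p′+l|^γ|x−x′|^γ ≤ CL^{−γk}|p′+l|^γ», «So keeping γ + α < 1, the error produced
by the above replacement is bounded by CL^{−γk}.»  (renders ref1 p016/p017, king p024/p025 read as
images by this seat.)

WHAT THIS MODULE PROVES (kernel, [folklore], our constants).  Write `q = q̃_k` for the symmetric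
representative of the alias class `k` at the fibre `s` (`symmAlias`), `∂^{(n)}_ν = dSym n`,
`Δ^{(n)} = DeltaXir n 0` (the free symbol of `Δ_a` off the zone centre), `W(q) = aliasWeight s (jOf n k s)`
(King's (4.20) weight of the class; `q = aliasPt s (jOf n k s)` by `symmAlias_eq_aliasPt`).
 §1 `aliasWeight_mul_norm_le`: **`W(q)·‖q‖_∞ ≤ π`** for every class (the weight carries exactly one
    negative power of the largest momentum component) — hence `W(q)²·‖q‖_∞ ≤ π`, `W(q)²‖q‖²_∞ ≤ π²`.
 §2 the ORDER-TWO diagonal weight `w2 n k s ν ν′ = ∂^{(n)}_ν(q)·conj ∂^{(n)}_{ν′}(q)·Δ^{(n)}(q)⁻¹` (the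
    free-diagonal entry of the sandwich `D_{∂_ν} G D_{∂_{ν′}}^*`, cf. `B5G183RateObstructionOp.weight_mul_diag`)
    and its eta-rate on PAIRED classes WITH the weight:
    **`diag_weight2_rate_le : W(q)²·‖w2 (RN) (ιk) − w2 N k‖ ≤ Cdg2/N`**, `Cdg2 = 3π³ + π⁴/24`, EVERY
    paired class including the centre, every `N, R ≥ 1`, `d`, `ν, ν′` — whereas WITHOUT the weight the
    same difference is `2/21` on the witness class of `B5G183RateObstruction.order_two_weight_no_rate`
    at every `N` (no rate at all).  Sources of the rate: `‖∂^{(RN)} − ∂^{(N)}‖ ≤ 6‖q‖²/N`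
    (`B5G183RateL2.dSym_rate_le`), `‖q‖²Δ⁻¹ ≤ π²/4` (`B5G183RateL2Op.norm_sq_mul_inv_DeltaXir_le`),
    `|Δ^{(RN)}(q)⁻¹ − Δ^{(N)}(q)⁻¹| ≤ (π²/24)/N²` (`B5G183RateSum.diag_paired_rate`), and §1.
 §3 UNPAIRED classes (King's `m ≠ 0`, `‖q″‖_∞ ≥ πN`): **`diag_weight2_unpaired_le :
    W(q″)²·‖w2 (RN) k″‖ ≤ (π²/4)/N²`** (the unweighted entry is `O(1)` there — it equals `1` when
    `q″ ∥ e_ν`, `ν = ν′`).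
 §4 `Dg2` = the weighted order-two free-diagonal difference on ALL classes of level `RN` (paired:
    `Wc²·(w2^{(RN)}(ιk) − w2^{(N)}(k))`; unpaired: `Wc²·w2^{(RN)}`, the planted operator being `0` there),
    `norm_Dg2_le` (sup ≤ (Cdg2 + π²/4)/N) and the OPERATOR statement **`opNorm_Dg2_le :
    ‖diagonal Dg2‖_(ℓ²→ℓ²) ≤ (Cdg2 + π²/4)/N`** (`B5G183RateL2Op.opNorm_diagonal_le`).
So at the symbol level the ORDER-TWO free diagonal, which is the EXACT obstruction behind the operator
no-go (`not_orderTwoOpRateResidual`: the naive uniform `ℓ²`-operator rate is false for every constant),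
acquires the full rate `O(1/N)` as soon as ONE King weight is inserted on each side — this is the room
King's printed condition «α + γ < 1» expresses (one negative power of momentum per gained power of
`L^{−k}`); our fibrewise setting has no Hölder loss, so `γ = 1` survives on the diagonal.

WHAT REMAINS / NOT CLAIMED: (i) the OPERATOR-level order-two rate in the weighted currency
`‖D_W·(D₂F_{RN}D₂* − plant_R(D₂F_N D₂*))·D_W‖ ≤ C/N^γ` (`D_W = diagonal(W)`): the finite-rank blocks
(x-block, rank-one block, zone-centre row/column) with TWO derivative weights are NOT estimated here
(the order-one machinery of `B5G183RateL2Op`/`B5G183RateL2Asm` is one-sided), and the exponent `γ`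
they allow is NOT determined here (King's printed regime is `α + γ < 1`); (ii) `p′`-derivatives,
`∫dp′`, position space, the exponential decay of Prop. 1.2 ((1.110)–(1.111) p. 35), `U ≠ 1`, optimal
constants; (iii) anything about print: the weighted statement is OURS, suggested by King's (4.19)–(4.20)
where the kernels always carry the averaging weights `u`.
-/

noncomputable section

namespace Literature.MathematicalPhysics.QuantumFieldTheory.Balaban1983to89.B5G183RateO2Diag

open scoped BigOperators ComplexConjugate
open Finset Complex
open Literature.MathematicalPhysics.QuantumFieldTheory.Balaban1983to89.B4Strip
open Literature.MathematicalPhysics.QuantumFieldTheory.Balaban1983to89.B5Prop11Fiber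
open Literature.MathematicalPhysics.QuantumFieldTheory.Balaban1983to89.B5Hk163Rate
open Literature.MathematicalPhysics.QuantumFieldTheory.Balaban1983to89.B5Hk163RateSum
open Literature.MathematicalPhysics.QuantumFieldTheory.Balaban1983to89.B5G183RateSum
open Literature.MathematicalPhysics.QuantumFieldTheory.Balaban1983to89.B5G183RateL2
open Literature.MathematicalPhysics.QuantumFieldTheory.Balaban1983to89.B5G183RateL2Op
open Literature.MathematicalPhysics.QuantumFieldTheory.Balaban1983to89.B5G183RateObstructionOp
open Literature.MathematicalPhysics.QuantumFieldTheory.King1986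

variable {d : ℕ}

/-! ## §1 King's alias weight carries one negative power of the largest momentum component [folklore] -/

section Weight

/-- a product of factors in `[0,1]` is at most any one of its factors. [folklore] -/
theorem prod_le_factor {f : Fin d → ℝ} (h0 : ∀ μ, 0 ≤ f μ) (h1 : ∀ μ, f μ ≤ 1) (μ : Fin d) :
    ∏ ν, f ν ≤ f μ := by
  rw [← Finset.mul_prod_erase Finset.univ f (Finset.mem_univ μ)]
  calc f μ * ∏ ν ∈ Finset.univ.erase μ, f ν ≤ f μ * 1 := by
        refine mul_le_mul_of_nonneg_left ?_ (h0 μ)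
        exact Finset.prod_le_one (fun ν _ => h0 ν) (fun ν _ => h1 ν)
    _ = f μ := mul_one _

/-- the `μ`-th factor of King's weight (4.20). [cite: King1986, (4.20) p.672] [folklore] -/
def wFactor (p : Fin d → ℝ) (j : Fin d → ℤ) (μ : Fin d) : ℝ :=
  if j μ = 0 then (1 : ℝ) else |p μ| / |p μ + 2 * Real.pi * j μ|

/-- `aliasWeight p j = Π_μ wFactor p j μ`. [folklore] -/
theorem aliasWeight_eq_prod (p : Fin d → ℝ) (j : Fin d → ℤ) :
    aliasWeight p j = ∏ μ, wFactor p j μ := rfl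

/-- `0 ≤ wFactor`. [folklore] -/
theorem wFactor_nonneg (p : Fin d → ℝ) (j : Fin d → ℤ) (μ : Fin d) : 0 ≤ wFactor p j μ := by
  unfold wFactor; split_ifs
  · exact zero_le_one
  · exact div_nonneg (abs_nonneg _) (abs_nonneg _)

/-- `wFactor ≤ 1` on the zone `|p_μ| ≤ π`. [cite: King1986, (4.20) p.672] [folklore] -/
theorem wFactor_le_one {p : Fin d → ℝ} (hp : ∀ μ, |p μ| ≤ Real.pi) (j : Fin d → ℤ) (μ : Fin d) :
    wFactor p j μ ≤ 1 := by
  have h := aliasWeight_le_one (d := 1) (p := fun _ => p μ) (fun _ => hp μ) (fun _ => j μ)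
  unfold aliasWeight at h
  rw [Fintype.prod_subsingleton _ (0 : Fin 1)] at h
  unfold wFactor
  exact h

/-- **each factor kills its own component: `wFactor_μ · |q_μ| ≤ π`**, `q = aliasPt p j`.
[cite: King1986, (4.20) p.672] [folklore] -/
theorem wFactor_mul_abs_le {p : Fin d → ℝ} (hp : ∀ μ, |p μ| ≤ Real.pi) (j : Fin d → ℤ) (μ : Fin d) :
    wFactor p j μ * |aliasPt p j μ| ≤ Real.pi := by
  unfold wFactor aliasPt
  split_ifs with hj
  · rw [hj]; push_cast; rw [mul_zero, add_zero, one_mul]; exact hp μ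
  · by_cases h0 : p μ + 2 * Real.pi * j μ = 0
    · rw [h0, abs_zero, mul_zero]; exact Real.pi_pos.le
    · rw [div_mul_cancel₀ _ (abs_ne_zero.mpr h0)]; exact hp μ

/-- **`W(q)·‖q‖_∞ ≤ π`** (`q = aliasPt p j`, sup norm): the weight is at most each of its factors, and
the `μ`-th factor times `|q_μ|` is at most `π`. [cite: King1986, (4.20) p.672] [folklore] -/
theorem aliasWeight_mul_norm_le {p : Fin d → ℝ} (hp : ∀ μ, |p μ| ≤ Real.pi) (j : Fin d → ℤ) :
    aliasWeight p j * ‖aliasPt p j‖ ≤ Real.pi := by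
  have hW0 : 0 ≤ aliasWeight p j := aliasWeight_nonneg p j
  by_cases hW : aliasWeight p j = 0
  · rw [hW, zero_mul]; exact Real.pi_pos.le
  have hWpos : 0 < aliasWeight p j := lt_of_le_of_ne hW0 (Ne.symm hW)
  rw [mul_comm, ← le_div_iff₀ hWpos]
  refine (pi_norm_le_iff_of_nonneg (div_nonneg Real.pi_pos.le hW0)).mpr fun μ => ?_
  rw [Real.norm_eq_abs, le_div_iff₀ hWpos, mul_comm]
  calc aliasWeight p j * |aliasPt p j μ|
      ≤ wFactor p j μ * |aliasPt p j μ| := by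
        rw [aliasWeight_eq_prod]
        exact mul_le_mul_of_nonneg_right
          (prod_le_factor (wFactor_nonneg p j) (wFactor_le_one hp j) μ) (abs_nonneg _)
    _ ≤ Real.pi := wFactor_mul_abs_le hp j μ

/-- `W(q)²·‖q‖_∞ ≤ π` (since `W ≤ 1`). [folklore] -/
theorem aliasWeight_sq_mul_norm_le {p : Fin d → ℝ} (hp : ∀ μ, |p μ| ≤ Real.pi) (j : Fin d → ℤ) :
    aliasWeight p j ^ 2 * ‖aliasPt p j‖ ≤ Real.pi := by
  have hW0 := aliasWeight_nonneg p j
  have hW1 := aliasWeight_le_one hp j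
  calc aliasWeight p j ^ 2 * ‖aliasPt p j‖
      = aliasWeight p j * (aliasWeight p j * ‖aliasPt p j‖) := by ring
    _ ≤ 1 * (aliasWeight p j * ‖aliasPt p j‖) :=
        mul_le_mul_of_nonneg_right hW1 (mul_nonneg hW0 (norm_nonneg _))
    _ ≤ Real.pi := by rw [one_mul]; exact aliasWeight_mul_norm_le hp j

/-- `W(q)²·‖q‖²_∞ ≤ π²`. [folklore] -/
theorem aliasWeight_sq_mul_norm_sq_le {p : Fin d → ℝ} (hp : ∀ μ, |p μ| ≤ Real.pi) (j : Fin d → ℤ) :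
    aliasWeight p j ^ 2 * ‖aliasPt p j‖ ^ 2 ≤ Real.pi ^ 2 := by
  rw [← mul_pow]
  exact pow_le_pow_left₀ (mul_nonneg (aliasWeight_nonneg p j) (norm_nonneg _))
    (aliasWeight_mul_norm_le hp j) 2

/-- the class weight: `Wc n k s = aliasWeight s (jOf n k s)` — King's (4.20) weight of the alias class
`k` of level `n` at the fibre `s`. [cite: King1986, (4.20) p.672] [folklore] -/
def Wc (n : ℕ) (k : Fin d → Fin n) (s : Fin d → ℝ) : ℝ := aliasWeight s (jOf n k s)

/-- `0 ≤ Wc ≤ 1`. [folklore] -/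
theorem Wc_nonneg_le_one {n : ℕ} (k : Fin d → Fin n) {s : Fin d → ℝ} (hs : ∀ μ, |s μ| ≤ Real.pi) :
    0 ≤ Wc n k s ∧ Wc n k s ≤ 1 := ⟨aliasWeight_nonneg _ _, aliasWeight_le_one hs _⟩

/-- `Wc²·‖q̃_k‖_∞ ≤ π` and `Wc²·‖q̃_k‖²_∞ ≤ π²` with `q̃_k = symmAlias n k s`. [folklore] -/
theorem Wc_sq_mul_norm_le {n : ℕ} (k : Fin d → Fin n) {s : Fin d → ℝ} (hs : ∀ μ, |s μ| ≤ Real.pi) :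
    Wc n k s ^ 2 * ‖symmAlias n k s‖ ≤ Real.pi
      ∧ Wc n k s ^ 2 * ‖symmAlias n k s‖ ^ 2 ≤ Real.pi ^ 2 := by
  unfold Wc; rw [symmAlias_eq_aliasPt]
  exact ⟨aliasWeight_sq_mul_norm_le hs _, aliasWeight_sq_mul_norm_sq_le hs _⟩

/-- the PAIRED class weight is level-independent: `Wc (RN) (ιk) s = Wc N k s` (same physical momentum).
[folklore] -/
theorem Wc_iota {N R : ℕ} [NeZero R] (hN : 1 ≤ N) (k : Fin d → Fin N) {s : Fin d → ℝ}
    (hs : ∀ μ, |s μ| ≤ Real.pi) : Wc (R * N) (iota R k s) s = Wc N k s := by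
  unfold Wc
  have h : aliasPt s (jOf (R * N) (iota R k s) s) = aliasPt s (jOf N k s) := by
    rw [← symmAlias_eq_aliasPt, ← symmAlias_eq_aliasPt, symmAlias_iota hN k hs]
  have hj : jOf (R * N) (iota R k s) s = jOf N k s := by
    funext μ
    have hμ := congr_fun h μ
    unfold aliasPt at hμ
    have h2 : (2 : ℝ) * Real.pi ≠ 0 := by positivity
    have e : 2 * Real.pi * ((jOf (R * N) (iota R k s) s μ : ℤ) : ℝ)
        = 2 * Real.pi * ((jOf N k s μ : ℤ) : ℝ) := by linarith
    exact_mod_cast mul_left_cancel₀ h2 e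
  rw [hj]

end Weight

/-! ## §2 The ORDER-TWO diagonal weight and its eta-rate on PAIRED classes, with the weight [folklore] -/

section Paired

variable {N R : ℕ} [NeZero N] [NeZero R]

/-- the ORDER-TWO free-diagonal entry `∂^{(n)}_ν(q̃_k)·conj ∂^{(n)}_{ν′}(q̃_k)·Δ^{(n)}(q̃_k)⁻¹` of the
sandwich `D_{∂_ν} G D^*_{∂_{ν′}}` at level `n` (cf. `B5G183RateObstructionOp.weight_mul_diag`).
[cite: Balaban1984PropagatorsI, (1.83) p.31, Prop. 1.1 (1.89) p.33] [folklore] -/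
def w2 (n : ℕ) (k : Fin d → Fin n) (s : Fin d → ℝ) (ν ν' : Fin d) : ℂ :=
  dSym n k s ν * conj (dSym n k s ν') * ((DeltaXir n 0 (symmAlias n k s) : ℝ) : ℂ)⁻¹

omit [NeZero N] [NeZero R] in
/-- complex bookkeeping for the three-term split
`A·B·a − A₀·B₀·b = (A − A₀)·B·a + A₀·(B − B₀)·a + A₀·B₀·(a − b)`. [folklore] -/
theorem norm_three_split_le (A A0 B B0 : ℂ) (a b : ℝ) :
    ‖A * B * (a : ℂ) - A0 * B0 * (b : ℂ)‖
      ≤ ‖A - A0‖ * ‖B‖ * |a| + ‖A0‖ * ‖B - B0‖ * |a| + ‖A0‖ * ‖B0‖ * |a - b| := by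
  have e : A * B * (a : ℂ) - A0 * B0 * (b : ℂ)
      = (A - A0) * B * (a : ℂ) + A0 * (B - B0) * (a : ℂ) + A0 * B0 * ((a : ℂ) - (b : ℂ)) := by ring
  rw [e, ← Complex.ofReal_sub]
  refine (norm_add₃_le).trans_eq ?_
  simp only [norm_mul, Complex.norm_real, Real.norm_eq_abs]

/-- constant of the weighted paired ORDER-TWO diagonal rate: `12·π·(π²/4) + π²·(π²/24)`. [folklore] -/
def Cdg2 : ℝ := 3 * Real.pi ^ 3 + Real.pi ^ 4 / 24

/-- `0 ≤ Cdg2`. [folklore] -/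
theorem Cdg2_nonneg : 0 ≤ Cdg2 := by unfold Cdg2; positivity

omit [NeZero N] in
/-- **PAIRED diagonal, ORDER-TWO weights, King weight on both sides, eta-rate (every class `k`, centre
included):** `Wc²·‖w2 (RN) (ιk) − w2 N k‖ ≤ Cdg2/N`.  The unweighted difference has NO rate
(`B5G183RateObstruction.order_two_weight_no_rate`: `2/21` on a witness class at every `N`); the weight
supplies `Wc²‖q‖ ≤ π`, which turns `‖∂^{(RN)} − ∂^{(N)}‖·‖∂‖·Δ⁻¹ ≤ (6‖q‖²/N)·‖q‖·Δ⁻¹ ≤ (3π²/2)‖q‖/N` into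
`O(1/N)` and `‖∂‖²·|Δ_{RN}⁻¹ − Δ_N⁻¹| ≤ ‖q‖²(π²/24)/N²` into `O(1/N²)`.
[cite: Balaban1984PropagatorsI, Prop. 1.1 (1.89) p.33; King1986, (4.20), (4.23) p.672, (4.24), (4.29)–(4.31) p.673]
[folklore] -/
theorem diag_weight2_rate_le (hN : 1 ≤ N) (hR : 1 ≤ R) {s : Fin d → ℝ} (hs : ∀ ν, |s ν| ≤ Real.pi)
    (ν₀ : Fin d) (hν₀ : s ν₀ ≠ 0) (k : Fin d → Fin N) (ν ν' : Fin d) :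
    Wc N k s ^ 2 * ‖w2 (R * N) (iota R k s) s ν ν' - w2 N k s ν ν'‖ ≤ Cdg2 / N := by
  have hπ := Real.pi_pos
  have hN0 : (0 : ℝ) < N := by exact_mod_cast hN
  have hN1 : (1 : ℝ) ≤ N := by exact_mod_cast hN
  have hRN : 1 ≤ R * N := one_le_RN hN hR
  unfold w2
  rw [symmAlias_iota hN k hs]
  set q := symmAlias N k s with hqdef
  have hr := isRep_symmAlias hN k hs
  have hpos : 0 < momSq q := momSq_pos_of_rep hs ν₀ hν₀ hr.exists_int
  have hzR : ∀ μ, |q μ| ≤ Real.pi * ((R * N : ℕ) : ℝ) := by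
    intro μ
    have h := (isRep_symmAlias hRN (iota R k s) hs).zone μ
    rwa [symmAlias_iota hN k hs] at h
  -- the four inputs
  have hA : ‖dSym (R * N) (iota R k s) s ν - dSym N k s ν‖ ≤ 6 * ‖q‖ ^ 2 / N :=
    dSym_rate_le hN hR k hs ν
  have hB : ‖conj (dSym (R * N) (iota R k s) s ν') - conj (dSym N k s ν')‖ ≤ 6 * ‖q‖ ^ 2 / N := by
    rw [← map_sub, Complex.norm_conj]; exact dSym_rate_le hN hR k hs ν'
  have hA0 : ‖dSym N k s ν‖ ≤ ‖q‖ := B5G183RateL2.norm_dSym_le hN k s ν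
  have hB0 : ‖conj (dSym N k s ν')‖ ≤ ‖q‖ := by
    rw [Complex.norm_conj]; exact B5G183RateL2.norm_dSym_le hN k s ν'
  have hBR : ‖conj (dSym (R * N) (iota R k s) s ν')‖ ≤ ‖q‖ := by
    rw [Complex.norm_conj]
    have h := B5G183RateL2.norm_dSym_le hRN (iota R k s) s ν'
    rwa [symmAlias_iota hN k hs] at h
  have ha : ‖q‖ ^ 2 * (DeltaXir (R * N) 0 q)⁻¹ ≤ Real.pi ^ 2 / 4 :=
    norm_sq_mul_inv_DeltaXir_le hRN hzR hpos
  have hapos : 0 < (DeltaXir (R * N) 0 q)⁻¹ :=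
    inv_pos.mpr (lt_of_lt_of_le (by positivity) (DeltaXir_ge_momSq hRN hzR))
  have hab : |(DeltaXir (R * N) 0 q)⁻¹ - (DeltaXir N 0 q)⁻¹| ≤ Real.pi ^ 2 / 24 * ((N : ℝ) ^ 2)⁻¹ := by
    rw [abs_sub_comm]; exact diag_paired_rate hN hR hs ν₀ hν₀ k
  have hW := (Wc_sq_mul_norm_le k hs)
  have hW0 : 0 ≤ Wc N k s ^ 2 := sq_nonneg _
  have hq0 : 0 ≤ ‖q‖ := norm_nonneg _
  rw [← Complex.ofReal_inv, ← Complex.ofReal_inv]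
  refine (mul_le_mul_of_nonneg_left (norm_three_split_le _ _ _ _ _ _) hW0).trans ?_
  rw [abs_of_pos hapos]
  -- term 1: W²·‖A − A₀‖·‖B‖·a ≤ W²·(6‖q‖²/N)·‖q‖·a = (6/N)·(W²‖q‖)·(‖q‖²a) ≤ (6/N)·π·(π²/4)
  have t1 : Wc N k s ^ 2 * (‖dSym (R * N) (iota R k s) s ν - dSym N k s ν‖
      * ‖conj (dSym (R * N) (iota R k s) s ν')‖ * (DeltaXir (R * N) 0 q)⁻¹)
      ≤ 6 / N * Real.pi * (Real.pi ^ 2 / 4) := by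
    calc Wc N k s ^ 2 * (‖dSym (R * N) (iota R k s) s ν - dSym N k s ν‖
          * ‖conj (dSym (R * N) (iota R k s) s ν')‖ * (DeltaXir (R * N) 0 q)⁻¹)
        ≤ Wc N k s ^ 2 * (6 * ‖q‖ ^ 2 / N * ‖q‖ * (DeltaXir (R * N) 0 q)⁻¹) := by
          refine mul_le_mul_of_nonneg_left ?_ hW0
          exact mul_le_mul_of_nonneg_right
            (mul_le_mul hA hBR (norm_nonneg _) (by positivity)) hapos.le
      _ = 6 / N * (Wc N k s ^ 2 * ‖q‖) * (‖q‖ ^ 2 * (DeltaXir (R * N) 0 q)⁻¹) := by ring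
      _ ≤ 6 / N * Real.pi * (Real.pi ^ 2 / 4) := by
          refine mul_le_mul (mul_le_mul_of_nonneg_left hW.1 (by positivity)) ha (by positivity)
            (by positivity)
  -- term 2: the same with the roles of ν, ν′ exchanged
  have t2 : Wc N k s ^ 2 * (‖dSym N k s ν‖
      * ‖conj (dSym (R * N) (iota R k s) s ν') - conj (dSym N k s ν')‖ * (DeltaXir (R * N) 0 q)⁻¹)
      ≤ 6 / N * Real.pi * (Real.pi ^ 2 / 4) := by
    calc Wc N k s ^ 2 * (‖dSym N k s ν‖
          * ‖conj (dSym (R * N) (iota R k s) s ν') - conj (dSym N k s ν')‖ * (DeltaXir (R * N) 0 q)⁻¹)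
        ≤ Wc N k s ^ 2 * (‖q‖ * (6 * ‖q‖ ^ 2 / N) * (DeltaXir (R * N) 0 q)⁻¹) := by
          refine mul_le_mul_of_nonneg_left ?_ hW0
          exact mul_le_mul_of_nonneg_right
            (mul_le_mul hA0 hB (norm_nonneg _) hq0) hapos.le
      _ = 6 / N * (Wc N k s ^ 2 * ‖q‖) * (‖q‖ ^ 2 * (DeltaXir (R * N) 0 q)⁻¹) := by ring
      _ ≤ 6 / N * Real.pi * (Real.pi ^ 2 / 4) := by
          refine mul_le_mul (mul_le_mul_of_nonneg_left hW.1 (by positivity)) ha (by positivity)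
            (by positivity)
  -- term 3: W²·‖A₀‖·‖B₀‖·|a − b| ≤ (W²‖q‖²)·(π²/24)/N² ≤ π²·(π²/24)/N²
  have t3 : Wc N k s ^ 2 * (‖dSym N k s ν‖ * ‖conj (dSym N k s ν')‖
      * |(DeltaXir (R * N) 0 q)⁻¹ - (DeltaXir N 0 q)⁻¹|)
      ≤ Real.pi ^ 2 * (Real.pi ^ 2 / 24 * ((N : ℝ) ^ 2)⁻¹) := by
    calc Wc N k s ^ 2 * (‖dSym N k s ν‖ * ‖conj (dSym N k s ν')‖
          * |(DeltaXir (R * N) 0 q)⁻¹ - (DeltaXir N 0 q)⁻¹|)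
        ≤ Wc N k s ^ 2 * (‖q‖ * ‖q‖ * (Real.pi ^ 2 / 24 * ((N : ℝ) ^ 2)⁻¹)) := by
          refine mul_le_mul_of_nonneg_left ?_ hW0
          exact mul_le_mul (mul_le_mul hA0 hB0 (norm_nonneg _) hq0) hab (abs_nonneg _)
            (by positivity)
      _ = Wc N k s ^ 2 * ‖q‖ ^ 2 * (Real.pi ^ 2 / 24 * ((N : ℝ) ^ 2)⁻¹) := by ring
      _ ≤ Real.pi ^ 2 * (Real.pi ^ 2 / 24 * ((N : ℝ) ^ 2)⁻¹) :=
          mul_le_mul_of_nonneg_right hW.2 (by positivity)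
  have hsum := add_le_add (add_le_add t1 t2) t3
  rw [mul_add, mul_add]
  refine hsum.trans ?_
  -- 12/N·π·π²/4 + π⁴/24/N² ≤ (3π³ + π⁴/24)/N
  have hN2 : ((N : ℝ) ^ 2)⁻¹ ≤ (N : ℝ)⁻¹ := by
    apply inv_anti₀ hN0; nlinarith
  calc 6 / N * Real.pi * (Real.pi ^ 2 / 4) + 6 / N * Real.pi * (Real.pi ^ 2 / 4)
        + Real.pi ^ 2 * (Real.pi ^ 2 / 24 * ((N : ℝ) ^ 2)⁻¹)
      ≤ 6 / N * Real.pi * (Real.pi ^ 2 / 4) + 6 / N * Real.pi * (Real.pi ^ 2 / 4)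
        + Real.pi ^ 2 * (Real.pi ^ 2 / 24 * (N : ℝ)⁻¹) := by gcongr
    _ = Cdg2 / N := by unfold Cdg2; field_simp; ring

end Paired

/-! ## §3 UNPAIRED classes: the weight alone gives `O(N⁻²)` [folklore] -/

section Unpaired

variable {N R : ℕ} [NeZero N] [NeZero R]

omit [NeZero N] in
/-- **UNPAIRED diagonal, ORDER-TWO weights, King weight on both sides:** on King's `|m| ≥ 1` classes
(`‖q″‖_∞ ≥ πN`) `Wc²·‖w2 (RN) k″‖ ≤ (π²/4)/N²`: `‖w2‖ ≤ ‖q″‖²Δ⁻¹ ≤ π²/4` and `Wc² ≤ π²/‖q″‖² ≤ N⁻²`.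
WITHOUT the weight this entry is `O(1)` (it equals `1` when `q″ ∥ e_ν`, `ν = ν′`).
[cite: King1986, (4.19)–(4.20) p.672; Balaban1984PropagatorsI, Prop. 1.1 (1.89) p.33] [folklore] -/
theorem diag_weight2_unpaired_le (hN : 1 ≤ N) (hR : 1 ≤ R) {s : Fin d → ℝ} (hs : ∀ ν, |s ν| ≤ Real.pi)
    {k'' : Fin d → Fin (R * N)} (hu : ∀ k : Fin d → Fin N, iota R k s ≠ k'') (ν ν' : Fin d) :
    Wc (R * N) k'' s ^ 2 * ‖w2 (R * N) k'' s ν ν'‖ ≤ Real.pi ^ 2 / 4 / (N : ℝ) ^ 2 := by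
  have hπ := Real.pi_pos
  have hN0 : (0 : ℝ) < N := by exact_mod_cast hN
  have hRN : 1 ≤ R * N := one_le_RN hN hR
  unfold w2
  set q := symmAlias (R * N) k'' s with hqdef
  have hr := isRep_symmAlias hRN k'' hs
  have hfar : Real.pi * N ≤ ‖q‖ := norm_ge_of_unpaired hN hs hu
  have hqpos : 0 < ‖q‖ := lt_of_lt_of_le (by positivity) hfar
  have hmpos : 0 < momSq q := lt_of_lt_of_le (by positivity) (norm_sq_le_momSq q)
  have ha : ‖q‖ ^ 2 * (DeltaXir (R * N) 0 q)⁻¹ ≤ Real.pi ^ 2 / 4 :=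
    norm_sq_mul_inv_DeltaXir_le hRN hr.zone hmpos
  have hapos : 0 < (DeltaXir (R * N) 0 q)⁻¹ :=
    inv_pos.mpr (lt_of_lt_of_le (by positivity) (DeltaXir_ge_momSq hRN hr.zone))
  have hA : ‖dSym (R * N) k'' s ν‖ ≤ ‖q‖ := B5G183RateL2.norm_dSym_le hRN k'' s ν
  have hB : ‖conj (dSym (R * N) k'' s ν')‖ ≤ ‖q‖ := by
    rw [Complex.norm_conj]; exact B5G183RateL2.norm_dSym_le hRN k'' s ν'
  have hW := (Wc_sq_mul_norm_le k'' hs).2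
  have hW0 : 0 ≤ Wc (R * N) k'' s ^ 2 := sq_nonneg _
  -- ‖w2‖ ≤ ‖q‖²·Δ⁻¹ ≤ π²/4
  have hw : ‖dSym (R * N) k'' s ν * conj (dSym (R * N) k'' s ν')
      * ((DeltaXir (R * N) 0 q : ℝ) : ℂ)⁻¹‖ ≤ ‖q‖ ^ 2 * (DeltaXir (R * N) 0 q)⁻¹ := by
    rw [← Complex.ofReal_inv, norm_mul, norm_mul, Complex.norm_real, Real.norm_eq_abs,
      abs_of_pos hapos, sq]
    exact mul_le_mul_of_nonneg_right (mul_le_mul hA hB (norm_nonneg _) (norm_nonneg _)) hapos.le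
  -- Wc² ≤ π²/‖q‖² ≤ 1/N²
  have hWq : Wc (R * N) k'' s ^ 2 ≤ ((N : ℝ) ^ 2)⁻¹ := by
    have h2 : Real.pi ^ 2 * (N : ℝ) ^ 2 ≤ ‖q‖ ^ 2 := by
      rw [← mul_pow]; exact pow_le_pow_left₀ (by positivity) hfar 2
    have h3 : Wc (R * N) k'' s ^ 2 * (Real.pi ^ 2 * (N : ℝ) ^ 2) ≤ Real.pi ^ 2 :=
      (mul_le_mul_of_nonneg_left h2 hW0).trans hW
    have h3' : Wc (R * N) k'' s ^ 2 * (N : ℝ) ^ 2 * Real.pi ^ 2 ≤ 1 * Real.pi ^ 2 := by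
      calc Wc (R * N) k'' s ^ 2 * (N : ℝ) ^ 2 * Real.pi ^ 2
          = Wc (R * N) k'' s ^ 2 * (Real.pi ^ 2 * (N : ℝ) ^ 2) := by ring
        _ ≤ Real.pi ^ 2 := h3
        _ = 1 * Real.pi ^ 2 := (one_mul _).symm
    have h4 : Wc (R * N) k'' s ^ 2 * (N : ℝ) ^ 2 ≤ 1 := le_of_mul_le_mul_right h3' (by positivity)
    rw [← one_div, le_div_iff₀ (by positivity)]; exact h4
  calc Wc (R * N) k'' s ^ 2 * ‖dSym (R * N) k'' s ν * conj (dSym (R * N) k'' s ν')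
        * ((DeltaXir (R * N) 0 q : ℝ) : ℂ)⁻¹‖
      ≤ ((N : ℝ) ^ 2)⁻¹ * (Real.pi ^ 2 / 4) :=
        mul_le_mul hWq (hw.trans ha) (norm_nonneg _) (by positivity)
    _ = Real.pi ^ 2 / 4 / (N : ℝ) ^ 2 := by ring

end Unpaired

/-! ## §4 The weighted ORDER-TWO free diagonal as an operator on the level-`RN` classes [folklore] -/

section Operator

open scoped Matrix.Norms.L2Operator
open Literature.MathematicalPhysics.QuantumFieldTheory.Balaban1983to89.B5G183RateOp

variable {N R : ℕ} [NeZero N] [NeZero R]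

/-- the WEIGHTED order-two free-diagonal difference at a class `K` of level `RN`: on a paired class
`K = ιk` the entry `Wc²·(w2^{(RN)}(ιk) − w2^{(N)}(k))`, on an unpaired class `Wc²·w2^{(RN)}(K)` (the
planted level-`N` operator vanishes there). [cite: King1986, (4.19)–(4.20) p.672] [folklore] -/
def Dg2 (N R : ℕ) [NeZero N] [NeZero R] (s : Fin d → ℝ) (ν ν' : Fin d) (K : Fin d → Fin (R * N)) : ℂ :=
  match unpair R s K with
  | none => ((Wc (R * N) K s ^ 2 : ℝ) : ℂ) * w2 (R * N) K s ν ν'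
  | some k => ((Wc N k s ^ 2 : ℝ) : ℂ) * (w2 (R * N) K s ν ν' - w2 N k s ν ν')

/-- `Dg2` at a paired class. [folklore] -/
theorem Dg2_iota (hN : 1 ≤ N) {s : Fin d → ℝ} (hs : ∀ ν, |s ν| ≤ Real.pi) (ν ν' : Fin d)
    (k : Fin d → Fin N) :
    Dg2 N R s ν ν' (iota R k s)
      = ((Wc N k s ^ 2 : ℝ) : ℂ) * (w2 (R * N) (iota R k s) s ν ν' - w2 N k s ν ν') := by
  unfold Dg2
  simp only [unpair_iota hN hs]

/-- `Dg2` at an unpaired class. [folklore] -/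
theorem Dg2_unpaired {s : Fin d → ℝ} (ν ν' : Fin d) {K : Fin d → Fin (R * N)}
    (hu : ∀ k : Fin d → Fin N, iota R k s ≠ K) :
    Dg2 N R s ν ν' K = ((Wc (R * N) K s ^ 2 : ℝ) : ℂ) * w2 (R * N) K s ν ν' := by
  unfold Dg2
  simp only [unpair_of_unpaired hu]

/-- **SUP bound of the weighted order-two diagonal:** `‖Dg2(K)‖ ≤ (Cdg2 + π²/4)/N` for every class `K`
of level `RN` (`diag_weight2_rate_le` on the paired classes, `diag_weight2_unpaired_le` on the unpaired
ones, `N⁻² ≤ N⁻¹`). [cite: King1986, (4.20), (4.23) p.672] [folklore] -/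
theorem norm_Dg2_le (hN : 1 ≤ N) (hR : 1 ≤ R) {s : Fin d → ℝ} (hs : ∀ ν, |s ν| ≤ Real.pi)
    (ν₀ : Fin d) (hν₀ : s ν₀ ≠ 0) (ν ν' : Fin d) (K : Fin d → Fin (R * N)) :
    ‖Dg2 N R s ν ν' K‖ ≤ (Cdg2 + Real.pi ^ 2 / 4) / N := by
  have hπ := Real.pi_pos
  have hN0 : (0 : ℝ) < N := by exact_mod_cast hN
  have hN1 : (1 : ℝ) ≤ N := by exact_mod_cast hN
  have hC := Cdg2_nonneg
  by_cases hp : ∃ k : Fin d → Fin N, iota R k s = K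
  · obtain ⟨k, rfl⟩ := hp
    rw [Dg2_iota hN hs ν ν' k, norm_mul, Complex.norm_real, Real.norm_eq_abs, abs_of_nonneg (sq_nonneg _)]
    calc _ ≤ Cdg2 / N := diag_weight2_rate_le hN hR hs ν₀ hν₀ k ν ν'
      _ ≤ (Cdg2 + Real.pi ^ 2 / 4) / N := by gcongr; linarith [sq_nonneg Real.pi]
  · push Not at hp
    rw [Dg2_unpaired ν ν' hp, norm_mul, Complex.norm_real, Real.norm_eq_abs, abs_of_nonneg (sq_nonneg _)]
    calc _ ≤ Real.pi ^ 2 / 4 / (N : ℝ) ^ 2 := diag_weight2_unpaired_le hN hR hs hp ν ν'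
      _ ≤ Real.pi ^ 2 / 4 / N := by
          apply div_le_div_of_nonneg_left (by positivity) hN0; nlinarith
      _ ≤ (Cdg2 + Real.pi ^ 2 / 4) / N := by gcongr; linarith

/-- **the weighted order-two free diagonal as an OPERATOR** on `ℓ²` of the level-`RN` classes (one
direction pair `(ν, ν′)` at a time): `‖diagonal Dg2‖_(ℓ²→ℓ²) ≤ (Cdg2 + π²/4)/N` — the diagonal piece of
the weighted order-two eta-rate, i.e. exactly the piece whose UNWEIGHTED version carries the operator
no-go `B5G183RateObstructionOp.not_orderTwoOpRateResidual`. [cite: Balaban1984PropagatorsI, Prop. 1.1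
(1.89) p.33; King1986, (4.19)–(4.20), (4.23) p.672] [folklore] -/
theorem opNorm_Dg2_le (hN : 1 ≤ N) (hR : 1 ≤ R) {s : Fin d → ℝ} (hs : ∀ ν, |s ν| ≤ Real.pi)
    (ν₀ : Fin d) (hν₀ : s ν₀ ≠ 0) (ν ν' : Fin d) :
    ‖Matrix.diagonal (Dg2 N R s ν ν')‖ ≤ (Cdg2 + Real.pi ^ 2 / 4) / N := by
  have hN0 : (0 : ℝ) < N := by exact_mod_cast hN
  exact opNorm_diagonal_le _ (by have := Cdg2_nonneg; positivity)
    (fun K => norm_Dg2_le hN hR hs ν₀ hν₀ ν ν' K)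

end Operator

end Literature.MathematicalPhysics.QuantumFieldTheory.Balaban1983to89.B5G183RateO2Diag
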